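import Summits.CriticalPhenomena.PercolationContinuityZ3.Theorems.Transplant.FKConnectivityAllQPat3SPGoodDefs
import Summits.CriticalPhenomena.PercolationContinuityZ3.Theorems.Transplant.FKConnectivityAllQPat3OneSided
import Summits.CriticalPhenomena.PercolationContinuityZ3.Theorems.Transplant.FKConnectivityAllQPat3FamSteps
import Summits.CriticalPhenomena.PercolationContinuityZ3.Theorems.Transplant.FKConnectivityAllQPat3StarApex
import Summits.CriticalPhenomena.PercolationContinuityZ3.Theorems.Transplant.FKConnectivityAllQPat3ThetaTsymData3
import Summits.CriticalPhenomena.PercolationContinuityZ3.Theorems.Transplant.FKConnectivityAllQPat3ThetaStarData3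
import Summits.CriticalPhenomena.PercolationContinuityZ3.Theorems.Transplant.FKConnectivityAllQPat3RingTsymData3
import Summits.CriticalPhenomena.PercolationContinuityZ3.Theorems.Transplant.FKConnectivityAllQPat3RingStarData3
import Summits.CriticalPhenomena.PercolationContinuityZ3.Theorems.Transplant.FKConnectivityAllQPat3CornerTsymData
import Summits.CriticalPhenomena.PercolationContinuityZ3.Theorems.Transplant.FKConnectivityAllQPat3CornerStarData
import Summits.CriticalPhenomena.PercolationContinuityZ3.Theorems.Transplant.FKConnectivityAllQPat3CornerStarSData
import Summits.CriticalPhenomena.PercolationContinuityZ3.Theorems.Transplant.FKConnectivityAllQPat3CornerStarTData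
import Summits.CriticalPhenomena.PercolationContinuityZ3.Theorems.Transplant.FKConnectivityAllQPat3Cut1TsymData
import Summits.CriticalPhenomena.PercolationContinuityZ3.Theorems.Transplant.FKConnectivityAllQPat3Cut1StarData
import Summits.CriticalPhenomena.PercolationContinuityZ3.Theorems.Transplant.FKConnectivityAllQPat3Cut1StarYData
import Summits.CriticalPhenomena.PercolationContinuityZ3.Theorems.Transplant.FKConnectivityAllQPat3Cut1StarSData
import Summits.CriticalPhenomena.PercolationContinuityZ3.Theorems.Transplant.FKConnectivityAllQPat3CutSTsymData
import Summits.CriticalPhenomena.PercolationContinuityZ3.Theorems.Transplant.FKConnectivityAllQPat3CutSStarData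
import Summits.CriticalPhenomena.PercolationContinuityZ3.Theorems.Transplant.FKConnectivityAllQPat3CutSStarYData
import Summits.CriticalPhenomena.PercolationContinuityZ3.Theorems.Transplant.FKConnectivityAllQPat3CutSStarSData
import HarnessLib

/-!
# Connectivity correlation inequalities for `φ_{w,q}`, every `q > 0` — THEOREM SP, the seven certified STEPS in `SPGood` form

Proof file (`--supports stmt-CriticalPhenomena-4575`), census lineage (gen 37) of LANE 2's FK sub-programme; builds on p205010
(kernel theorem, internal audit signed; external expert review pending).  No definitions, no named facts, no sorries.

The leaves of census g37's structural recursion for THEOREM SP on two-terminal series–parallel networks, each packaged as ONE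
statement concluding `FK.SPGood` (all four members `T_sym`, `STAR` apex `b`/`s`/`t`, levelwise) from the kernel-checked
certificates of census g36 (THEOREM SP Stage S1/S2/S3) and the one-sided law of `…Pat3OneSided.lean`:
* `FK.spGood_inner` — THEOREM 𝒯₁ (`famT12_nonneg`, members 0–3): marks = the two terminals and an inner vertex;
* `FK.spGood_parTwo` — the one-sided 2-cut law when the cut consists of two marks (`famT12_par_step` + 𝒯₁);
* `FK.spGood_cutS` — a mark separating the other two (UNCONDITIONAL, census g36's `cutS*_level_nonneg`);
* `FK.spGood_cut1` — one-vertex gluing at an unmarked vertex, marks `2 | 1`, from `SPGood` of the 3-marked side read with the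
  cut vertex as third mark (census g36's `cut1*_level_nonneg`);
* `FK.spGood_oneSided` — one-vertex gluing with all marks on one side (`lev2_union_oneSided_nonneg`);
* `FK.spGood_corner` — two TTSP pieces in parallel, marks = one common terminal + one inner vertex of each (census g36's CORNER
  certificates `corner*_level_nonneg`);
* `FK.spGood_theta` / `FK.spGood_ring` — THETA and RING gluings of three TTSP pieces with one inner mark each (census g34's
  THEOREM SP certificates, kernel form census g36: `theta*`/`ring*_level_nonneg` and the other apices of `…Pat3StarApex.lean`).
Vertex sets are the spans `{z | ∃ e ∈ E, z ∈ e}` and all side conditions are stated in the style of `FK.IsTTSP`'s constructors.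
[cite: AyyerLinussonRavichandran2025, §7 (p. 22)] [cite: Grimmett2006, §3.8 (pp. 61–62)]
-/

namespace Summit.CriticalPhenomena.PercolationContinuityZ3.Theorems

namespace FK

open SimpleGraph Literature.Probability.LatticeModels Literature.Probability.Percolation
open scoped Classical

variable {V : Type*} [Fintype V]

section Steps

omit [Fintype V] in
/-- The span of an edge set contains the ends of its edges (the trivial vertex-set hypothesis of the gluing lemmas). [folklore] -/
theorem spanE_mem (E : Finset (Sym2 V)) : ∀ e ∈ (↑E : Set (Sym2 V)), ∀ a ∈ e, a ∈ {z : V | ∃ e ∈ E, z ∈ e} :=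
  fun e he _ ha => ⟨e, Finset.mem_coe.1 he, ha⟩

/-- **STEP S1 (THEOREM 𝒯₁):** on a two-terminal series–parallel network, the placement (terminal, terminal, inner vertex) is good.
[cite: AyyerLinussonRavichandran2025, §7 (p. 22)] -/
theorem spGood_inner {E : Finset (Sym2 V)} {x y s : V} (hE : IsTTSP E x y) (hs : ∃ e ∈ E, s ∈ e) (hsx : s ≠ x)
    (hsy : s ≠ y) : SPGood E x y s :=
  SPGood.of_mval2 (fun _ hw => famT12_nonneg hE hs hsx hsy hw 0) (fun _ hw => famT12_nonneg hE hs hsx hsy hw 1)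
    (fun _ hw => famT12_nonneg hE hs hsx hsy hw 2) (fun _ hw => famT12_nonneg hE hs hsx hsy hw 3)

/-- **STEP P2 (one-sided 2-cut through two marks):** `E₁` any part meeting the two-terminal series–parallel `(x, y)`-network `E₂`
inside `{x, y}`, `s` an inner vertex of `E₂`: the placement `(x, y, s)` is good on `E₁ ∪ E₂`. [cite: AyyerLinussonRavichandran2025, §7 (p. 22)] -/
theorem spGood_parTwo {E₁ E₂ : Finset (Sym2 V)} {x y s : V} (hd : Disjoint E₁ E₂)
    (hV : ∀ z : V, (∃ e ∈ E₁, z ∈ e) → (∃ e ∈ E₂, z ∈ e) → z = x ∨ z = y) (hxy : x ≠ y) (h₂ : IsTTSP E₂ x y)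
    (hs : ∃ e ∈ E₂, s ∈ e) (hsx : s ≠ x) (hsy : s ≠ y) : SPGood (E₁ ∪ E₂) x y s := by
  have hS : {z : V | ∃ e ∈ E₁, z ∈ e} ∩ {z : V | ∃ e ∈ E₂, z ∈ e} ⊆ ({x, y} : Set V) := fun z hz => by
    rcases hV z hz.1 hz.2 with h | h <;> simp [h]
  have hsV : s ∉ {z : V | ∃ e ∈ E₁, z ∈ e} := fun h => by
    rcases hV s h hs with h' | h'
    · exact hsx h'
    · exact hsy h'
  have step := fun i w hw => famT12_par_step hd (spanE_mem E₁) (spanE_mem E₂) hS hxy hsV hsx hsy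
    (fun j w' hw' => famT12_nonneg h₂ hs hsx hsy hw' j) w hw i
  exact SPGood.of_mval2 (fun w hw => step 0 w hw) (fun w hw => step 1 w hw) (fun w hw => step 2 w hw)
    (fun w hw => step 3 w hw)

/-- **STEP CS (a mark separating the other two; unconditional):** `E₁`, `E₂` edge-disjoint with spans meeting only in the mark `s`,
`x` on `E₁` and `y` on `E₂` off `s`: the placement `(x, y, s)` is good on `E₁ ∪ E₂`. [cite: AyyerLinussonRavichandran2025, §7 (p. 22)] -/
theorem spGood_cutS {E₁ E₂ : Finset (Sym2 V)} {x y s : V} (hd : Disjoint E₁ E₂)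
    (hV : ∀ z : V, (∃ e ∈ E₁, z ∈ e) → (∃ e ∈ E₂, z ∈ e) → z = s) (hx : ∃ e ∈ E₁, x ∈ e) (hy : ∃ e ∈ E₂, y ∈ e)
    (hxs : x ≠ s) (hys : y ≠ s) : SPGood (E₁ ∪ E₂) x y s := by
  have hS : {z : V | ∃ e ∈ E₁, z ∈ e} ∩ {z : V | ∃ e ∈ E₂, z ∈ e} ⊆ ({s} : Set V) := fun z hz =>
    Set.mem_singleton_iff.2 (hV z hz.1 hz.2)
  have hxV : x ∉ {z : V | ∃ e ∈ E₂, z ∈ e} := fun h => hxs (hV x hx h)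
  have hyV : y ∉ {z : V | ∃ e ∈ E₁, z ∈ e} := fun h => hys (hV y h hy)
  have hxy : x ≠ y := fun h => hxs (hV x hx (h ▸ hy))
  exact SPGood.of_mul Nat.one_pos Nat.one_pos Nat.one_pos Nat.one_pos
    (cutSTsym_level_nonneg hd (spanE_mem E₁) (spanE_mem E₂) hS hxV hyV hxs hys hxy)
    (cutSStar_level_nonneg hd (spanE_mem E₁) (spanE_mem E₂) hS hxV hyV hxs hys hxy)
    (cutSStarY_level_nonneg hd (spanE_mem E₁) (spanE_mem E₂) hS hxV hyV hxs hys hxy)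
    (cutSStarS_level_nonneg hd (spanE_mem E₁) (spanE_mem E₂) hS hxV hyV hxs hys hxy)

/-- **STEP C1 (one-vertex gluing at an unmarked vertex `w`, marks `2 | 1`):** if `(x, w, s)` is good on `E₁` (the side carrying
`x` and `s`) then `(x, y, s)` is good on `E₁ ∪ E₂` for every `E₂` glued at `w` carrying `y`. [cite: AyyerLinussonRavichandran2025, §7 (p. 22)] -/
theorem spGood_cut1 {E₁ E₂ : Finset (Sym2 V)} {w x y s : V} (hd : Disjoint E₁ E₂)
    (hV : ∀ z : V, (∃ e ∈ E₁, z ∈ e) → (∃ e ∈ E₂, z ∈ e) → z = w) (hx : ∃ e ∈ E₁, x ∈ e) (hs : ∃ e ∈ E₁, s ∈ e)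
    (hy : ∃ e ∈ E₂, y ∈ e) (hxw : x ≠ w) (hsw : s ≠ w) (hyw : y ≠ w) (hA : SPGood E₁ x w s) :
    SPGood (E₁ ∪ E₂) x y s := by
  have hS : {z : V | ∃ e ∈ E₁, z ∈ e} ∩ {z : V | ∃ e ∈ E₂, z ∈ e} ⊆ ({w} : Set V) := fun z hz =>
    Set.mem_singleton_iff.2 (hV z hz.1 hz.2)
  have hxV : x ∉ {z : V | ∃ e ∈ E₂, z ∈ e} := fun h => hxw (hV x hx h)
  have hsV : s ∉ {z : V | ∃ e ∈ E₂, z ∈ e} := fun h => hsw (hV s hs h)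
  have hyV : y ∉ {z : V | ∃ e ∈ E₁, z ∈ e} := fun h => hyw (hV y h hy)
  have hxy : x ≠ y := fun h => hxw (hV x hx (h ▸ hy))
  have hsy : s ≠ y := fun h => hsw (hV s hs (h ▸ hy))
  exact SPGood.of_mul Nat.two_pos Nat.two_pos Nat.one_pos Nat.two_pos
    (cut1Tsym_level_nonneg hd (spanE_mem E₁) (spanE_mem E₂) hS hxV hsV hyV hxw hyw hxy hsw hsy fun μ => (hA μ).1)
    (cut1Star_level_nonneg hd (spanE_mem E₁) (spanE_mem E₂) hS hxV hsV hyV hxw hyw hxy hsw hsy fun μ => (hA μ).2.1)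
    (cut1StarY_level_nonneg hd (spanE_mem E₁) (spanE_mem E₂) hS hxV hsV hyV hxw hyw hxy hsw hsy fun μ => (hA μ).2.2.1)
    (cut1StarS_level_nonneg hd (spanE_mem E₁) (spanE_mem E₂) hS hxV hsV hyV hxw hyw hxy hsw hsy fun μ => (hA μ).2.2.2)

/-- **STEP O1 (one-vertex gluing, all marks on one side):** if `(b, s, t)` is good on `E₁` and `E₂` is glued along at most one
vertex `m`, the marks lying on `E₁`, then `(b, s, t)` is good on `E₁ ∪ E₂`. [cite: AyyerLinussonRavichandran2025, §7 (p. 22)] -/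
theorem spGood_oneSided {E₁ E₂ : Finset (Sym2 V)} {m b s t : V} (hd : Disjoint E₁ E₂)
    (hV : ∀ z : V, (∃ e ∈ E₁, z ∈ e) → (∃ e ∈ E₂, z ∈ e) → z = m) (hb : ∃ e ∈ E₁, b ∈ e) (hs : ∃ e ∈ E₁, s ∈ e)
    (ht : ∃ e ∈ E₁, t ∈ e) (hbs : b ≠ s) (hbt : b ≠ t) (hst : s ≠ t) (hA : SPGood E₁ b s t) :
    SPGood (E₁ ∪ E₂) b s t := by
  have hS : {z : V | ∃ e ∈ E₁, z ∈ e} ∩ {z : V | ∃ e ∈ E₂, z ∈ e} ⊆ ({m} : Set V) := fun z hz =>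
    Set.mem_singleton_iff.2 (hV z hz.1 hz.2)
  have side : ∀ p : V, (∃ e ∈ E₁, p ∈ e) → p ∉ {z : V | ∃ e ∈ E₂, z ∈ e} ∨ p = m := fun p hp => by
    by_cases hpm : p = m
    · exact Or.inr hpm
    · exact Or.inl fun h => hpm (hV p hp h)
  intro μ
  exact ⟨lev2_union_oneSided_nonneg hd (spanE_mem E₁) (spanE_mem E₂) hS (side b hb) (side s hs) (side t ht) hbs hbt hst _
      (fun ν => (hA ν).1) μ,
    lev2_union_oneSided_nonneg hd (spanE_mem E₁) (spanE_mem E₂) hS (side b hb) (side s hs) (side t ht) hbs hbt hst _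
      (fun ν => (hA ν).2.1) μ,
    lev2_union_oneSided_nonneg hd (spanE_mem E₁) (spanE_mem E₂) hS (side b hb) (side s hs) (side t ht) hbs hbt hst _
      (fun ν => (hA ν).2.2.1) μ,
    lev2_union_oneSided_nonneg hd (spanE_mem E₁) (spanE_mem E₂) hS (side b hb) (side s hs) (side t ht) hbs hbt hst _
      (fun ν => (hA ν).2.2.2) μ⟩

/-- **STEP CORNER (type-II 2-cut through a mark; census g32 §4.1/§4.2, kernel census g36):** two two-terminal series–parallel
`(u, v)`-pieces in parallel, `s` inner in the first and `t` inner in the second: the placement `(u, s, t)` is good on the union.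
[cite: AyyerLinussonRavichandran2025, §7 (p. 22)] -/
theorem spGood_corner {Q₁ Q₂ : Finset (Sym2 V)} {u v s t : V} (hd : Disjoint Q₁ Q₂)
    (hV : ∀ z : V, (∃ e ∈ Q₁, z ∈ e) → (∃ e ∈ Q₂, z ∈ e) → z = u ∨ z = v) (h₁ : IsTTSP Q₁ u v) (h₂ : IsTTSP Q₂ u v)
    (hs : ∃ e ∈ Q₁, s ∈ e) (ht : ∃ e ∈ Q₂, t ∈ e) (hsu : s ≠ u) (hsv : s ≠ v) (htu : t ≠ u) (htv : t ≠ v) :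
    SPGood (Q₁ ∪ Q₂) u s t := by
  have hS : {z : V | ∃ e ∈ Q₁, z ∈ e} ∩ {z : V | ∃ e ∈ Q₂, z ∈ e} ⊆ ({u, v} : Set V) := fun z hz => by
    rcases hV z hz.1 hz.2 with h | h <;> simp [h]
  have hs2 : s ∉ {z : V | ∃ e ∈ Q₂, z ∈ e} := fun h => by
    rcases hV s hs h with h' | h'
    · exact hsu h'
    · exact hsv h'
  have ht1 : t ∉ {z : V | ∃ e ∈ Q₁, z ∈ e} := fun h => by
    rcases hV t h ht with h' | h'
    · exact htu h'
    · exact htv h'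
  have hst : s ≠ t := fun h => ht1 (h ▸ hs)
  have huv : u ≠ v := h₁.ne
  have h4 : 0 < 4 := by norm_num
  exact SPGood.of_mul h4 h4 h4 h4
    (cornerTsym_level_nonneg hd (spanE_mem Q₁) (spanE_mem Q₂) hS huv hs2 ht1 hsu hsv htu htv hst h₁ h₂ hs ht)
    (cornerStar_level_nonneg hd (spanE_mem Q₁) (spanE_mem Q₂) hS huv hs2 ht1 hsu hsv htu htv hst h₁ h₂ hs ht)
    (cornerStarS_level_nonneg hd (spanE_mem Q₁) (spanE_mem Q₂) hS huv hs2 ht1 hsu hsv htu htv hst h₁ h₂ hs ht)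
    (cornerStarT_level_nonneg hd (spanE_mem Q₁) (spanE_mem Q₂) hS huv hs2 ht1 hsu hsv htu htv hst h₁ h₂ hs ht)

/-- **STEP THETA (census g34's THEOREM SP certificates THETA_TS / THETA_STAR, kernel census g36):** three two-terminal
series–parallel `(u, v)`-pieces in parallel with spans pairwise meeting inside `{u, v}`, one inner mark on each: the placement
`(b, s, t)` is good on the union. [cite: AyyerLinussonRavichandran2025, §7 (p. 22)] -/
theorem spGood_theta {EK E₁ E₂ : Finset (Sym2 V)} {u v b s t : V} (hdK1 : Disjoint EK E₁) (hdK2 : Disjoint EK E₂)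
    (hd12 : Disjoint E₁ E₂) (hVK1 : ∀ z : V, (∃ e ∈ EK, z ∈ e) → (∃ e ∈ E₁, z ∈ e) → z = u ∨ z = v)
    (hVK2 : ∀ z : V, (∃ e ∈ EK, z ∈ e) → (∃ e ∈ E₂, z ∈ e) → z = u ∨ z = v)
    (hV12 : ∀ z : V, (∃ e ∈ E₁, z ∈ e) → (∃ e ∈ E₂, z ∈ e) → z = u ∨ z = v)
    (hK : IsTTSP EK u v) (h₁ : IsTTSP E₁ u v) (h₂ : IsTTSP E₂ u v)
    (hb : ∃ e ∈ EK, b ∈ e) (hs : ∃ e ∈ E₁, s ∈ e) (ht : ∃ e ∈ E₂, t ∈ e)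
    (hbu : b ≠ u) (hbv : b ≠ v) (hsu : s ≠ u) (hsv : s ≠ v) (htu : t ≠ u) (htv : t ≠ v) :
    SPGood (EK ∪ E₁ ∪ E₂) b s t := by
  have pair : ∀ {A B : Finset (Sym2 V)}, (∀ z : V, (∃ e ∈ A, z ∈ e) → (∃ e ∈ B, z ∈ e) → z = u ∨ z = v) →
      {z : V | ∃ e ∈ A, z ∈ e} ∩ {z : V | ∃ e ∈ B, z ∈ e} ⊆ ({u, v} : Set V) := fun h z hz => by
    rcases h z hz.1 hz.2 with h' | h' <;> simp [h']
  have off : ∀ {A B : Finset (Sym2 V)} {p : V}, (∀ z : V, (∃ e ∈ A, z ∈ e) → (∃ e ∈ B, z ∈ e) → z = u ∨ z = v) →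
      (∃ e ∈ A, p ∈ e) → p ≠ u → p ≠ v → p ∉ {z : V | ∃ e ∈ B, z ∈ e} := fun h hp hpu hpv hpB => by
    rcases h _ hp hpB with h' | h'
    · exact hpu h'
    · exact hpv h'
  have off' : ∀ {A B : Finset (Sym2 V)} {p : V}, (∀ z : V, (∃ e ∈ A, z ∈ e) → (∃ e ∈ B, z ∈ e) → z = u ∨ z = v) →
      (∃ e ∈ B, p ∈ e) → p ≠ u → p ≠ v → p ∉ {z : V | ∃ e ∈ A, z ∈ e} := fun h hp hpu hpv hpA => by
    rcases h _ hpA hp with h' | h'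
    · exact hpu h'
    · exact hpv h'
  have hb1 := off hVK1 hb hbu hbv
  have hb2 := off hVK2 hb hbu hbv
  have hsK := off' hVK1 hs hsu hsv
  have hs2 := off hV12 hs hsu hsv
  have htK := off' hVK2 ht htu htv
  have ht1 := off' hV12 ht htu htv
  have hbs : b ≠ s := fun h => hb1 (h ▸ hs)
  have hbt : b ≠ t := fun h => hb2 (h ▸ ht)
  have hst : s ≠ t := fun h => hs2 (h ▸ ht)
  have huv : u ≠ v := hK.ne
  exact SPGood.of_mul (by norm_num) (by norm_num) (by norm_num) (by norm_num)
    (thetaTsym_level_nonneg hdK1 hdK2 hd12 (spanE_mem EK) (spanE_mem E₁) (spanE_mem E₂) (pair hVK1) (pair hVK2) (pair hV12)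
      huv hb1 hb2 hsK hs2 htK ht1 hbu hbv hsu hsv htu htv hbs hbt hst hK h₁ h₂ hb hs ht)
    (thetaStar_level_nonneg hdK1 hdK2 hd12 (spanE_mem EK) (spanE_mem E₁) (spanE_mem E₂) (pair hVK1) (pair hVK2) (pair hV12)
      huv hb1 hb2 hsK hs2 htK ht1 hbu hbv hsu hsv htu htv hbs hbt hst hK h₁ h₂ hb hs ht)
    (thetaStar_apex₁_level_nonneg hdK1 hdK2 hd12 (spanE_mem EK) (spanE_mem E₁) (spanE_mem E₂) (pair hVK1) (pair hVK2)
      (pair hV12) huv hb1 hb2 hsK hs2 htK ht1 hbu hbv hsu hsv htu htv hbs hbt hst hK h₁ h₂ hb hs ht)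
    (thetaStar_apex₂_level_nonneg hdK1 hdK2 hd12 (spanE_mem EK) (spanE_mem E₁) (spanE_mem E₂) (pair hVK1) (pair hVK2)
      (pair hV12) huv hb1 hb2 hsK hs2 htK ht1 hbu hbv hsu hsv htu htv hbs hbt hst hK h₁ h₂ hb hs ht)

/-- **STEP RING (census g34's THEOREM SP certificates RING_TS / RING_STAR, kernel census g36):** the ring
`K(v,u) · Q₁(u,w) · Q₂(w,v)` of three two-terminal series–parallel pieces meeting only at the corners `u, v, w`, one inner mark on
each: the placement `(b, s, t)` is good on the union. [cite: AyyerLinussonRavichandran2025, §7 (p. 22)] -/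
theorem spGood_ring {EK E₁ E₂ : Finset (Sym2 V)} {u v w b s t : V} (hdK1 : Disjoint EK E₁) (hdK2 : Disjoint EK E₂)
    (hd12 : Disjoint E₁ E₂) (hVK1 : ∀ z : V, (∃ e ∈ EK, z ∈ e) → (∃ e ∈ E₁, z ∈ e) → z = u)
    (hV12 : ∀ z : V, (∃ e ∈ E₁, z ∈ e) → (∃ e ∈ E₂, z ∈ e) → z = w)
    (hVK2 : ∀ z : V, (∃ e ∈ EK, z ∈ e) → (∃ e ∈ E₂, z ∈ e) → z = v)
    (hu2 : ¬ ∃ e ∈ E₂, u ∈ e) (hv1 : ¬ ∃ e ∈ E₁, v ∈ e) (huw : u ≠ w) (hvw : v ≠ w)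
    (hK : IsTTSP EK v u) (h₁ : IsTTSP E₁ u w) (h₂ : IsTTSP E₂ w v)
    (hb : ∃ e ∈ EK, b ∈ e) (hs : ∃ e ∈ E₁, s ∈ e) (ht : ∃ e ∈ E₂, t ∈ e)
    (hbu : b ≠ u) (hbv : b ≠ v) (hsu : s ≠ u) (hsw : s ≠ w) (htv : t ≠ v) (htw : t ≠ w) :
    SPGood (EK ∪ E₁ ∪ E₂) b s t := by
  have pK1 : {z : V | ∃ e ∈ EK, z ∈ e} ∩ {z : V | ∃ e ∈ E₁, z ∈ e} ⊆ ({u} : Set V) := fun z hz =>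
    Set.mem_singleton_iff.2 (hVK1 z hz.1 hz.2)
  have p12 : {z : V | ∃ e ∈ E₁, z ∈ e} ∩ {z : V | ∃ e ∈ E₂, z ∈ e} ⊆ ({w} : Set V) := fun z hz =>
    Set.mem_singleton_iff.2 (hV12 z hz.1 hz.2)
  have pK2 : {z : V | ∃ e ∈ EK, z ∈ e} ∩ {z : V | ∃ e ∈ E₂, z ∈ e} ⊆ ({v} : Set V) := fun z hz =>
    Set.mem_singleton_iff.2 (hVK2 z hz.1 hz.2)
  have huv : u ≠ v := hK.ne.symm
  have hb1 : b ∉ {z : V | ∃ e ∈ E₁, z ∈ e} := fun h => hbu (hVK1 b hb h)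
  have hb2 : b ∉ {z : V | ∃ e ∈ E₂, z ∈ e} := fun h => hbv (hVK2 b hb h)
  have hsK : s ∉ {z : V | ∃ e ∈ EK, z ∈ e} := fun h => hsu (hVK1 s h hs)
  have hs2 : s ∉ {z : V | ∃ e ∈ E₂, z ∈ e} := fun h => hsw (hV12 s hs h)
  have htK : t ∉ {z : V | ∃ e ∈ EK, z ∈ e} := fun h => htv (hVK2 t h ht)
  have ht1 : t ∉ {z : V | ∃ e ∈ E₁, z ∈ e} := fun h => htw (hV12 t h ht)
  have hsv : s ≠ v := fun h => hv1 (h ▸ hs)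
  have htu : t ≠ u := fun h => hu2 (h ▸ ht)
  have hbs : b ≠ s := fun h => hb1 (h ▸ hs)
  have hbt : b ≠ t := fun h => hb2 (h ▸ ht)
  have hst : s ≠ t := fun h => hs2 (h ▸ ht)
  have hu2' : u ∉ {z : V | ∃ e ∈ E₂, z ∈ e} := hu2
  have hv1' : v ∉ {z : V | ∃ e ∈ E₁, z ∈ e} := hv1
  exact SPGood.of_mul (by norm_num) (by norm_num) (by norm_num) (by norm_num)
    (ringTsym_level_nonneg hdK1 hdK2 hd12 (spanE_mem EK) (spanE_mem E₁) (spanE_mem E₂) pK1 p12 pK2 hu2' hv1' huv huw hvw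
      hb1 hb2 hsK hs2 htK ht1 hbu hbv hsu hsv hsw htu htv htw hbs hbt hst hK h₁ h₂ hb hs ht)
    (ringStar_level_nonneg hdK1 hdK2 hd12 (spanE_mem EK) (spanE_mem E₁) (spanE_mem E₂) pK1 p12 pK2 hu2' hv1' huv huw hvw
      hb1 hb2 hsK hs2 htK ht1 hbu hbv hsu hsv hsw htu htv htw hbs hbt hst hK h₁ h₂ hb hs ht)
    (ringStar_apex₁_level_nonneg hdK1 hdK2 hd12 (spanE_mem EK) (spanE_mem E₁) (spanE_mem E₂) pK1 p12 pK2 hu2' huv huw hvw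
      hb1 hb2 hsK hs2 htK ht1 hbu hbv hsu hsw htu htv htw hbs hbt hst hK h₁ h₂ hb hs ht)
    (ringStar_apex₂_level_nonneg hdK1 hdK2 hd12 (spanE_mem EK) (spanE_mem E₁) (spanE_mem E₂) pK1 p12 pK2 hv1' huv huw hvw
      hb1 hb2 hsK hs2 htK ht1 hbu hbv hsu hsv hsw htv htw hbs hbt hst hK h₁ h₂ hb hs ht)

end Steps

end FK

end Summit.CriticalPhenomena.PercolationContinuityZ3.Theorems
-- build-touch 2026-08-25T12:09:01Z T1-D (lead g18): re-land of p397682, declarations byte-identical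
-- build-touch 2026-08-25T18:27Z T1-D (lead g18): re-land of p399760, declarations byte-identical
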